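import Summits.QuantumFields.YangMills.Theorems.LuscherReductionOneSiteLevelsAbsLower
import Summits.QuantumFields.YangMills.Theorems.LuscherReductionOneSiteLevelsValleyFar
import Summits.QuantumFields.YangMills.Theorems.FemtoTransferGapLevelsDecay
import Literature.Analysis.OperatorTheory.YangMillsMatrixModelAL1Holds

/-!
# Crux RED `RunningReduction`, line «KTR» PART 8 — stub `TT.stub_oneSiteTail`, tool 8:
# the polynomial HILBERT–SCHMIDT ratio bound `Σ_{j≤n} (λ_j/λ_0)² ≤ C·B⁹`

Support module for crux `RunningReduction` (route `LuscherReduction`, item stmt-QuantumFields-19978), registered stub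
`TT.stub_oneSiteTail` (KTR PART 8; plan of record = ym-cruxidea-19978-2 g10's STUB-READING §2 S1), fleet base ym-luscher-20007-p1 (gen 4).

Tree inputs only: Bessel/Hilbert–Schmidt `Σ_{j≤n} λ_j² ≤ M²` for `K_B ≤ M` (`sum_levelValue_sq_le`) with `K_B ≤ e^{6B}` at `L = 1`
(`transferKernel_le_linkE`, `linkE_le`); the quasimode floor `λ_0 ≥ linkC³e^{−E₀λ_b − C_Lλ_b²}` (`oneSiteAbsLower_of_eigenfunctions` at `k = 0`,
discharged by the tree theorem `LuscherHamiltonianEigenfunctions_holds 0`); and the Gaussian floor of the link factor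
`linkCE B ≥ (1 − 27/B)·e^{6B}(π/B)^{9/2}(2π²)^{−3}` (`gauss_le_linkCE`).  Output (`hs_ratio`): `∃ C B0, ∀ B ≥ B0, ∀ n, Σ_{j≤n} (λ_j(B)/λ_0(B))² ≤ C·B⁹`.

HONEST FRAMING: one-site (`L = 1`) three-matrix `SU(2)` model, femto rung R2b1 bookkeeping; nothing here is infinite volume, a mass gap or Clay.
Sorry-free, no new definitions, no named-fact hypotheses.
-/

set_option autoImplicit false

noncomputable section

open MeasureTheory Filter Topology Real
open scoped BigOperators
open Literature.MathematicalPhysics.QuantumFieldTheory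
open Literature.MathematicalPhysics.QuantumLattice
open Literature.Analysis.OperatorTheory.YMMatrixModel

namespace Summit.QuantumFields.YangMills.Theorems.FemtoTransferGap.OST

open Summit.QuantumFields.YangMills.Theorems.FemtoTransferGap

/-- `K_B ≤ e^{6B}` pointwise at one site (`B ≥ 0`). [folklore] -/
theorem transferKernel_le_exp_six {B : ℝ} (hB : 0 ≤ B) (U V : Cfg) : transferKernel su2Rep B U V ≤ Real.exp (2 * B) ^ 3 := by
  have h := (transferKernel_le_linkE hB U V).trans (linkE_le hB U V)
  rwa [card_edge_one] at h

/-- The arithmetic of the ratio: from `Σ λ_j² ≤ M²`, `A ≤ λ_0`, `0 < A`, `M² ≤ C·A²`: `Σ λ_j²/λ_0² ≤ C`. [folklore] -/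
theorem ratio_arith {S M A lam0 C : ℝ} (hS : S ≤ M ^ 2) (hA : 0 < A) (hAl : A ≤ lam0) (hC : M ^ 2 ≤ C * A ^ 2) :
    S / lam0 ^ 2 ≤ C := by
  have hl0 : 0 < lam0 := hA.trans_le hAl
  have hC0 : 0 ≤ C := by
    by_contra h; push Not at h
    have : C * A ^ 2 < 0 := mul_neg_of_neg_of_pos h (pow_pos hA 2)
    nlinarith [sq_nonneg M]
  rw [div_le_iff₀ (pow_pos hl0 2)]
  have h1 : A ^ 2 ≤ lam0 ^ 2 := pow_le_pow_left₀ hA.le hAl 2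
  nlinarith

/-- **POLYNOMIAL HILBERT–SCHMIDT RATIO BOUND.**  There are `C` and `B0` such that for all `B ≥ B0` and all `n`:
`Σ_{j≤n} (λ_j(B)/λ_0(B))² ≤ C·B⁹`. [cite: ReedSimonI1980, Thm. VI.22] [cite: Luscher1983, §2] -/
theorem hs_ratio : ∃ C B0 : ℝ, ∀ B : ℝ, B0 ≤ B → ∀ n : ℕ,
    ∑ j : Fin (n + 1), (levelValue su2Rep 1 B j / levelValue su2Rep 1 B 0) ^ 2 ≤ C * B ^ 9 := by
  obtain ⟨CL, BL, hlow⟩ := oneSiteAbsLower_of_eigenfunctions (LuscherHamiltonianEigenfunctions_holds 0)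
  set c : ℝ := Real.exp (-(physLevel 1 + |CL|)) with hc
  have hc0 : 0 < c := Real.exp_pos _
  -- the constant: `e^{12B} = C' · B⁹ · A'²` with `A' = (1/2) e^{6B} (π/B)^{9/2} (2π²)^{-3} c`
  refine ⟨4 * (2 * π ^ 2) ^ 6 / (π ^ 9 * c ^ 2), max (max BL 54) 2, fun B hB n => ?_⟩
  have hBL : BL ≤ B := ((le_max_left _ _).trans (le_max_left _ _)).trans hB
  have hB54 : 54 ≤ B := ((le_max_right _ _).trans (le_max_left _ _)).trans hB
  have hB2 : 2 ≤ B := (le_max_right _ _).trans hB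
  have hBpos : 0 < B := by linarith
  have ht0 : 0 < bareLambda B := bareLambda_pos' hBpos
  have ht1 : bareLambda B ≤ 1 := bareLambda_le_of_le one_pos (by norm_num; linarith)
  set t := bareLambda B with ht
  -- Hilbert–Schmidt
  have hS := sum_levelValue_sq_le (L := 1) hBpos (fun U V => transferKernel_le_exp_six hBpos.le U V) n
  -- the floor `A ≤ λ_0`
  have hE0 : 0 ≤ physLevel 1 := physLevel_nonneg le_rfl
  have hCE : linkCE B = linkC B ^ 3 := by rw [linkCE, card_edge_one]
  have hgauss := gauss_le_linkCE hBpos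
  have hl := hlow B hBL
  set A : ℝ := 1 / 2 * (Real.exp (6 * B) * Real.sqrt (π / B) ^ 9 / (2 * π ^ 2) ^ 3) * c with hA
  have hG0 : 0 < Real.exp (6 * B) * Real.sqrt (π / B) ^ 9 / (2 * π ^ 2) ^ 3 := by positivity
  have hA0 : 0 < A := by rw [hA]; positivity
  have hexpc : c ≤ Real.exp (-(physLevel 1 * t) - CL * t ^ 2) := by
    rw [hc]; refine Real.exp_le_exp.mpr ?_
    have h1 : physLevel 1 * t ≤ physLevel 1 := by nlinarith
    have h2 : CL * t ^ 2 ≤ |CL| := by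
      have : t ^ 2 ≤ 1 := by nlinarith
      calc CL * t ^ 2 ≤ |CL| * t ^ 2 := mul_le_mul_of_nonneg_right (le_abs_self _) (sq_nonneg _)
        _ ≤ |CL| * 1 := mul_le_mul_of_nonneg_left this (abs_nonneg _)
        _ = |CL| := mul_one _
    linarith
  have hAle : A ≤ levelValue su2Rep 1 B 0 := by
    have h27 : (1 : ℝ) / 2 ≤ 1 - 27 / B := by
      have : 27 / B ≤ 1 / 2 := by rw [div_le_iff₀ hBpos]; linarith
      linarith
    have h1 : A ≤ linkCE B * c := by
      rw [hA]
      calc 1 / 2 * (Real.exp (6 * B) * Real.sqrt (π / B) ^ 9 / (2 * π ^ 2) ^ 3) * c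
          ≤ (1 - 27 / B) * (Real.exp (6 * B) * Real.sqrt (π / B) ^ 9 / (2 * π ^ 2) ^ 3) * c :=
            mul_le_mul_of_nonneg_right (mul_le_mul_of_nonneg_right h27 hG0.le) hc0.le
        _ ≤ linkCE B * c := mul_le_mul_of_nonneg_right hgauss hc0.le
    have h2 : linkCE B * c ≤ linkC B ^ 3 * Real.exp (-(physLevel 1 * t) - CL * t ^ 2) := by
      rw [hCE]; exact mul_le_mul_of_nonneg_left hexpc (pow_nonneg (linkC_pos hBpos.le).le 3)
    exact h1.trans (h2.trans hl)
  -- `M² ≤ C B⁹ A²`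
  have hsq9 : (Real.sqrt (π / B) ^ 9) ^ 2 = (π / B) ^ 9 := by
    rw [← pow_mul, show 9 * 2 = 2 * 9 by norm_num, pow_mul, Real.sq_sqrt (by positivity)]
  have hM : (Real.exp (2 * B) ^ 3) ^ 2 ≤ 4 * (2 * π ^ 2) ^ 6 / (π ^ 9 * c ^ 2) * B ^ 9 * A ^ 2 := by
    have e1 : (Real.exp (2 * B) ^ 3) ^ 2 = Real.exp (6 * B) ^ 2 := by
      rw [← Real.exp_nat_mul, ← Real.exp_nat_mul, ← Real.exp_nat_mul]; congr 1; push_cast; ring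
    set G : ℝ := Real.exp (6 * B) * Real.sqrt (π / B) ^ 9 / (2 * π ^ 2) ^ 3 with hGdef
    have hG2 : G ^ 2 = Real.exp (6 * B) ^ 2 * (π / B) ^ 9 / ((2 * π ^ 2) ^ 3) ^ 2 := by
      rw [hGdef, div_pow, mul_pow, hsq9]
    have hπ : 0 < π := Real.pi_pos
    have e2 : 4 * (2 * π ^ 2) ^ 6 / (π ^ 9 * c ^ 2) * B ^ 9 * A ^ 2 = Real.exp (6 * B) ^ 2 := by
      have eA : A ^ 2 = 1 / 4 * G ^ 2 * c ^ 2 := by rw [hA]; ring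
      rw [eA, hG2]
      field_simp
    rw [e1, e2]
  -- assemble
  have hsum : ∑ j : Fin (n + 1), (levelValue su2Rep 1 B j / levelValue su2Rep 1 B 0) ^ 2 =
      (∑ j : Fin (n + 1), levelValue su2Rep 1 B j ^ 2) / levelValue su2Rep 1 B 0 ^ 2 := by
    rw [Finset.sum_div]; exact Finset.sum_congr rfl fun j _ => by rw [div_pow]
  rw [hsum]
  have := ratio_arith hS hA0 hAle hM
  simpa [mul_comm, mul_assoc, mul_left_comm] using this

end Summit.QuantumFields.YangMills.Theorems.FemtoTransferGap.OST

end
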